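import Literature.Computability.AlgebraicComplexity.BI17FundamentalInvariantForms
import Literature.Computability.AlgebraicComplexity.ApolarityAction
import Mathlib.LinearAlgebra.Matrix.Permutation
import HarnessLib

/-!
# BI 2017, Prop. 2.4(2): the stabilizer of the power sum `X_1^D + ⋯ + X_m^D` — discharge of
# `BI2017_prop_2_4_2`

Sibling proofs file of `BI17FundamentalInvariantForms.lean` (val-lit cell, D-0074 GROUP L, row
`BI2017-A`; P. Bürgisser, C. Ikenmeyer, *Fundamental invariants of orbit closures*, J. Algebra 477
(2017) = arXiv:1511.02927, Prop. 2.4(2), cf. Chen–Kayal–Wigderson 2010, Ch. 2): "Suppose `D > 2` and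
`m > 1`. The stabilizer of the power sum `X_1^D + ⋯ + X_m^D` is the subgroup generated by the
permutation matrices and the diagonal matrices `diag(t_1,…,t_m)`, where `t_1^D = ⋯ = t_m^D = 1`. The
stabilizer period of `X_1^D + ⋯ + X_m^D` equals `D` if `D` is even and `2D` if `D` is odd." The parent
file types it as the named fact `BI2017_prop_2_4_2`; it is PROVED here (`BI2017_prop_2_4_2_holds`).

Proof. Let `γ` fix `p = ∑ X_i^D`, `L_j = γ · X_j = ∑_l γ_{lj} X_l`, so `∑_j L_j^D = p`. Taking the mixed
second partial `∂_b ∂_a` (`a ≠ b`; chain rule `pderiv_linSubst_eq_sum`) gives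
`D(D-1) ∑_j γ_{aj} γ_{bj} L_j^{D-2} = ∂_b ∂_a p = 0`; pulling back by `γ⁻¹` (`L_j ↦ X_j`) and reading
the coefficient of `X_j^{D-2}` (`D - 2 ≥ 1`) yields `γ_{aj} γ_{bj} = 0`: every column of `γ` has at most
one nonzero entry, hence exactly one (it is invertible), in pairwise distinct rows (else a zero row);
so `γ = P_π · diag(t)` (`exists_perm_diagonal_of_mem_linStabilizer_psum`), and comparing the
coefficients of `X_j^D` in `∑ t_j^D X_{π⁻¹ j}^D = p` gives `t_j^D = 1`. Conversely such matrices
stabilize `p`. The determinants of the stabilizer are `sign(π) ∏ t_j`, i.e. exactly the group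
`{±1}·μ_D = μ_N`, `N = D` (`D` even) or `2D` (`D` odd) — `−1` from a transposition (`m ≥ 2`),
`ζ ∈ μ_D` from `diag(ζ,1,…,1)`, and for odd `D` an `N`-th root `u` with `u^D = -1` from
`transposition · diag(-u,1,…,1)`; `|μ_N| = N` (`Complex.card_rootsOfUnity`). Typed literature;
`VP ≠ VNP` is not proved and nothing here is progress on it.

## References
* [BurgisserIkenmeyer2017] P. Bürgisser, C. Ikenmeyer, J. Algebra 477 (2017) 390–434 =
  arXiv:1511.02927, §2.1 Prop. 2.4(2) (TeX L500; held p0006:L76).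
-/

noncomputable section

open MvPolynomial Matrix

namespace Literature.Computability.AlgebraicComplexity

section PowerSumStabilizer

variable {k : Type*} [Field k] {m : ℕ}

/-- Entries of a permutation matrix: `P_π j i = [π j = i]` (private helper). [folklore] -/
private theorem permMatrix_entry (π : Equiv.Perm (Fin m)) (j i : Fin m) :
    π.permMatrix k j i = if π j = i then 1 else 0 := by
  rw [Equiv.Perm.permMatrix, PEquiv.toMatrix_toPEquiv_apply, Pi.single_apply]
  by_cases h : π j = i
  · rw [if_pos h, if_pos h.symm]
  · rw [if_neg h, if_neg (Ne.symm h)]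

/-- A monomial matrix `P_π · diag(t)` substitutes `X_i ↦ t_i X_{π⁻¹ i}` (private helper). [folklore] -/
private theorem linSubst_monomialMatrix_X (π : Equiv.Perm (Fin m)) (t : Fin m → k) (i : Fin m) :
    linSubst (Fin m) k (π.permMatrix k * diagonal t) (X i) =
      t i • (X (π.symm i) : MvPolynomial (Fin m) k) := by
  rw [linSubst_X, Finset.sum_eq_single (π.symm i)]
  · rw [mul_diagonal, permMatrix_entry, Equiv.apply_symm_apply, if_pos rfl, one_mul]
  · intro j _ hj
    rw [mul_diagonal, permMatrix_entry, if_neg, zero_mul, zero_smul]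
    intro h
    exact hj (by rw [← h, Equiv.symm_apply_apply])
  · intro h
    exact absurd (Finset.mem_univ _) h

/-- A monomial matrix `P_π · diag(t)` maps `∑ X_i^D` to `∑ t_i^D X_{π⁻¹ i}^D` (private helper).
[folklore] -/
private theorem linSubst_monomialMatrix_psum (π : Equiv.Perm (Fin m)) (t : Fin m → k) (D : ℕ) :
    linSubst (Fin m) k (π.permMatrix k * diagonal t) (∑ i : Fin m, X i ^ D) =
      ∑ i : Fin m, t i ^ D • (X (π.symm i) : MvPolynomial (Fin m) k) ^ D := by
  rw [map_sum]
  refine Finset.sum_congr rfl fun i _ => ?_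
  rw [map_pow, linSubst_monomialMatrix_X, smul_pow]

/-- The permutation matrix `P_π` as an element of `GL_m` (private helper). [folklore] -/
private theorem exists_gl_eq_permMatrix (π : Equiv.Perm (Fin m)) :
    ∃ P : GL (Fin m) k, (P : Matrix (Fin m) (Fin m) k) = π.permMatrix k :=
  ⟨Matrix.GeneralLinearGroup.mkOfDetNeZero (π.permMatrix k) (by
    rw [det_permutation]
    rcases Int.units_eq_one_or (Equiv.Perm.sign π) with h1 | h1 <;> simp [h1]),
    Matrix.GeneralLinearGroup.val_mkOfDetNeZero _ _⟩

/-- A diagonal matrix of `D`-th roots of unity (`D ≠ 0`) as an element of `GL_m` (private helper).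
[folklore] -/
private theorem exists_gl_eq_diagonal_of_pow_eq_one {D : ℕ} (hD : D ≠ 0) (t : Fin m → k)
    (ht : ∀ i, t i ^ D = 1) :
    ∃ T : GL (Fin m) k, (T : Matrix (Fin m) (Fin m) k) = diagonal t :=
  ⟨Matrix.GeneralLinearGroup.mkOfDetNeZero (diagonal t) (by
    rw [det_diagonal]
    exact Finset.prod_ne_zero_iff.mpr fun i _ h0 => by
      have := ht i
      rw [h0, zero_pow hD] at this
      exact zero_ne_one this),
    Matrix.GeneralLinearGroup.val_mkOfDetNeZero _ _⟩

/-- `∂_j (∑_i X_i^D) = D · X_j^{D-1}` (private helper). [folklore] -/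
private theorem pderiv_psum (D : ℕ) (j : Fin m) :
    pderiv j (∑ i : Fin m, (X i : MvPolynomial (Fin m) k) ^ D) =
      (D : MvPolynomial (Fin m) k) * X j ^ (D - 1) := by
  rw [map_sum, Finset.sum_eq_single j]
  · rw [(pderiv j).leibniz_pow, pderiv_X, Pi.single_eq_same, smul_eq_mul, mul_one, nsmul_eq_mul]
  · intro i _ hij
    rw [(pderiv j).leibniz_pow, pderiv_X, Pi.single_eq_of_ne hij, smul_zero, smul_zero]
  · intro h
    exact absurd (Finset.mem_univ _) h

/-- `∂_b (γ · X_j) = γ_{bj}` (a constant; private helper). [folklore] -/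
private theorem pderiv_linSubst_X' (A : Matrix (Fin m) (Fin m) k) (b j : Fin m) :
    pderiv b (linSubst (Fin m) k A (X j)) = C (A b j) := by
  rw [linSubst_X, map_sum, Finset.sum_eq_single b]
  · rw [Derivation.map_smul, pderiv_X, Pi.single_eq_same, smul_eq_C_mul, mul_one]
  · intro l _ hlb
    rw [Derivation.map_smul, pderiv_X, Pi.single_eq_of_ne hlb, smul_zero]
  · intro h
    exact absurd (Finset.mem_univ _) h

/-- `∂_b (L_j^n) = n γ_{bj} · L_j^{n-1}` for the linear form `L_j = γ · X_j` (private helper).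
[folklore] -/
private theorem pderiv_linSubst_X_pow (A : Matrix (Fin m) (Fin m) k) (b j : Fin m) (n : ℕ) :
    pderiv b (linSubst (Fin m) k A (X j) ^ n) =
      C ((n : k) * A b j) * linSubst (Fin m) k A (X j) ^ (n - 1) := by
  rw [(pderiv b).leibniz_pow, pderiv_linSubst_X', smul_eq_mul, nsmul_eq_mul, map_mul,
    map_natCast]
  ring

/-- The mixed second partial of the power sum vanishes: `∂_b ∂_a (∑ X_i^D) = 0` for `a ≠ b`
(private helper). [folklore] -/
private theorem pderiv_pderiv_psum_eq_zero (D : ℕ) {a b : Fin m} (hab : a ≠ b) :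
    pderiv b (pderiv a (∑ i : Fin m, (X i : MvPolynomial (Fin m) k) ^ D)) = 0 := by
  rw [pderiv_psum, ← map_natCast (C : k →+* MvPolynomial (Fin m) k), pderiv_C_mul,
    (pderiv b).leibniz_pow, pderiv_X, Pi.single_eq_of_ne hab, smul_zero, smul_zero, mul_zero]

/-- **Columns of a stabilizing matrix are monomial.** If `γ · (∑ X_i^D) = ∑ X_i^D` with `D ≥ 3`
(characteristic zero, `γ` invertible), then `γ_{aj} γ_{bj} = 0` for all `a ≠ b`: compare
`∂_b ∂_a` of both sides and pull back by `γ⁻¹` (private helper).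
[cite: BurgisserIkenmeyer2017, Prop. 2.4(2)] -/
private theorem entry_mul_entry_eq_zero [CharZero k] {D : ℕ} (hD : 2 < D) (γ : GL (Fin m) k)
    (hγ : linSubst (Fin m) k (γ : Matrix (Fin m) (Fin m) k) (∑ i : Fin m, X i ^ D) =
      ∑ i : Fin m, (X i : MvPolynomial (Fin m) k) ^ D)
    {a b : Fin m} (hab : a ≠ b) (j : Fin m) :
    (γ : Matrix (Fin m) (Fin m) k) a j * (γ : Matrix (Fin m) (Fin m) k) b j = 0 := by
  classical
  set A : Matrix (Fin m) (Fin m) k := (γ : Matrix (Fin m) (Fin m) k) with hA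
  -- the mixed partial of `γ · p`, computed term by term
  have hE : pderiv b (pderiv a (linSubst (Fin m) k A (∑ i : Fin m, X i ^ D))) =
      ∑ l : Fin m, C ((D : k) * (((D - 1 : ℕ) : k) * (A a l * A b l))) *
        linSubst (Fin m) k A (X l) ^ (D - 2) := by
    rw [map_sum, map_sum, map_sum]
    refine Finset.sum_congr rfl fun l _ => ?_
    rw [map_pow, pderiv_linSubst_X_pow, pderiv_C_mul, pderiv_linSubst_X_pow, ← mul_assoc, ← map_mul,
      show D - 1 - 1 = D - 2 by omega]
    congr 2
    ring
  rw [hγ, pderiv_pderiv_psum_eq_zero D hab] at hE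
  -- pull back by `γ⁻¹`: `L_l ↦ X_l`
  have hback : ∀ q : MvPolynomial (Fin m) k,
      linSubst (Fin m) k ((γ⁻¹ : GL (Fin m) k) : Matrix (Fin m) (Fin m) k) (linSubst (Fin m) k A q) = q := by
    intro q
    rw [hA, ← linSubstRep_apply, ← linSubstRep_apply, ← Module.End.mul_apply, ← map_mul,
      inv_mul_cancel, map_one, Module.End.one_apply]
  have h0 := congrArg (linSubst (Fin m) k ((γ⁻¹ : GL (Fin m) k) : Matrix (Fin m) (Fin m) k)) hE.symm
  rw [map_zero, map_sum] at h0
  have h1 : ∑ l : Fin m, C ((D : k) * (((D - 1 : ℕ) : k) * (A a l * A b l))) *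
      (X l : MvPolynomial (Fin m) k) ^ (D - 2) = 0 := by
    rw [← h0]
    refine Finset.sum_congr rfl fun l _ => ?_
    rw [map_mul (linSubst (Fin m) k ((γ⁻¹ : GL (Fin m) k) : Matrix (Fin m) (Fin m) k)), map_pow,
      hback, linSubst_C]
  -- read off the coefficient of `X_j^{D-2}`
  have hc := congrArg (coeff (Finsupp.single j (D - 2))) h1
  rw [coeff_zero, coeff_sum, Finset.sum_eq_single j] at hc
  · rw [coeff_C_mul, coeff_X_pow, if_pos rfl, mul_one] at hc
    have hD0 : (D : k) ≠ 0 := by exact_mod_cast (show D ≠ 0 by omega)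
    have hD1 : ((D - 1 : ℕ) : k) ≠ 0 := by exact_mod_cast (show D - 1 ≠ 0 by omega)
    simpa [hD0, hD1] using hc
  · intro l _ hlj
    rw [coeff_C_mul, coeff_X_pow, if_neg, mul_zero]
    intro h
    exact hlj ((Finsupp.single_left_inj (show D - 2 ≠ 0 by omega)).mp h)
  · intro h
    exact absurd (Finset.mem_univ _) h

/-- **Normal form of the stabilizer of `X_1^D + ⋯ + X_m^D` (`D ≥ 3`, characteristic zero)**: an
invertible `γ` whose substitution fixes the power sum is a monomial matrix `P_π · diag(t)` with
`t_j^D = 1` for all `j` (BI 2017, Prop. 2.4(2): "generated by the permutation matrices and the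
diagonal matrices `diag(t_1,…,t_m)`, where `t_1^D = ⋯ = t_m^D = 1`").
[cite: BurgisserIkenmeyer2017, Prop. 2.4(2)] -/
theorem exists_perm_diagonal_of_mem_linStabilizer_psum [CharZero k] {D : ℕ} (hD : 2 < D)
    (γ : GL (Fin m) k)
    (hγ : γ ∈ linStabilizer (∑ i : Fin m, (X i : MvPolynomial (Fin m) k) ^ D)) :
    ∃ (π : Equiv.Perm (Fin m)) (t : Fin m → k), (∀ j, t j ^ D = 1) ∧
      (γ : Matrix (Fin m) (Fin m) k) = π.permMatrix k * diagonal t := by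
  classical
  rw [mem_linStabilizer, linSubstRep_apply] at hγ
  have hmul := fun (a b : Fin m) (hab : a ≠ b) (j : Fin m) => entry_mul_entry_eq_zero hD γ hγ hab j
  -- every column has a nonzero entry …
  have hcol : ∀ j : Fin m, ∃ a : Fin m, (γ : Matrix (Fin m) (Fin m) k) a j ≠ 0 := by
    intro j
    by_contra h
    simp only [ne_eq, not_exists, not_not] at h
    exact Matrix.GeneralLinearGroup.det_ne_zero γ (det_eq_zero_of_column_eq_zero j h)
  choose g hg using hcol
  -- … and no other: column `j` is supported on the row `g j`
  have hsupp : ∀ j b, b ≠ g j → (γ : Matrix (Fin m) (Fin m) k) b j = 0 := by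
    intro j b hb
    have := hmul (g j) b (Ne.symm hb) j
    exact (mul_eq_zero.mp this).resolve_left (hg j)
  -- `g` is injective: otherwise some row is zero
  have hinj : Function.Injective g := by
    by_contra hne
    have hns : ¬ Function.Surjective g := fun hs => hne (Finite.injective_iff_surjective.mpr hs)
    obtain ⟨r, hr⟩ : ∃ r, ∀ j, g j ≠ r := by
      simpa [Function.Surjective] using hns
    exact Matrix.GeneralLinearGroup.det_ne_zero γ
      (det_eq_zero_of_row_eq_zero r fun j => hsupp j r (hr j).symm)
  let π : Equiv.Perm (Fin m) := (Equiv.ofBijective g (Finite.injective_iff_bijective.mp hinj)).symm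
  have hπ : ∀ j, π.symm j = g j := fun j => rfl
  set t : Fin m → k := fun j => (γ : Matrix (Fin m) (Fin m) k) (g j) j with ht
  have hmat : (γ : Matrix (Fin m) (Fin m) k) = π.permMatrix k * diagonal t := by
    ext b j
    rw [mul_diagonal, permMatrix_entry]
    by_cases h : π b = j
    · rw [if_pos h, one_mul, ht]
      simp only
      rw [← hπ, ← h, Equiv.symm_apply_apply]
    · rw [if_neg h, zero_mul]
      apply hsupp j b
      intro hb
      exact h (by rw [hb, ← hπ, Equiv.apply_symm_apply])
  refine ⟨π, t, fun j => ?_, hmat⟩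
  -- `t_j^D = 1`: compare the coefficients of `X_{g j}^D`
  rw [hmat, linSubst_monomialMatrix_psum] at hγ
  have hD0 : D ≠ 0 := by omega
  have hc := congrArg (coeff (Finsupp.single (g j) D)) hγ
  rw [coeff_sum, coeff_sum, Finset.sum_eq_single j, Finset.sum_eq_single (g j)] at hc
  · rw [coeff_smul, coeff_X_pow, hπ, if_pos rfl, coeff_X_pow, if_pos rfl, smul_eq_mul, mul_one] at hc
    exact hc
  · intro i _ hij
    rw [coeff_X_pow, if_neg]
    exact fun h => hij ((Finsupp.single_left_inj hD0).mp h)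
  · intro h; exact absurd (Finset.mem_univ _) h
  · intro i _ hij
    rw [coeff_smul, coeff_X_pow, hπ, if_neg, smul_zero]
    exact fun h => hij (hinj ((Finsupp.single_left_inj hD0).mp h))
  · intro h; exact absurd (Finset.mem_univ _) h

/-- **Monomial matrices of `D`-th roots of unity stabilize `X_1^D + ⋯ + X_m^D`** (the easy
inclusion of Prop. 2.4(2)). [cite: BurgisserIkenmeyer2017, Prop. 2.4(2)] -/
theorem mem_linStabilizer_psum_of_coe_eq {D : ℕ} (γ : GL (Fin m) k) (π : Equiv.Perm (Fin m))
    (t : Fin m → k) (ht : ∀ j, t j ^ D = 1)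
    (h : (γ : Matrix (Fin m) (Fin m) k) = π.permMatrix k * diagonal t) :
    γ ∈ linStabilizer (∑ i : Fin m, (X i : MvPolynomial (Fin m) k) ^ D) := by
  rw [mem_linStabilizer, linSubstRep_apply, h, linSubst_monomialMatrix_psum]
  simp_rw [ht, one_smul]
  exact Equiv.sum_comp π.symm (fun i => (X i : MvPolynomial (Fin m) k) ^ D)

/-- **BI 2017, Prop. 2.4(2), first sentence (characteristic zero, `D ≥ 3`)**: the stabilizer of
`X_1^D + ⋯ + X_m^D` in `GL_m` is generated by the permutation matrices and the diagonal matrices of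
`D`-th roots of unity. [cite: BurgisserIkenmeyer2017, Prop. 2.4(2)] -/
theorem linStabilizer_psum_eq_closure [CharZero k] {D : ℕ} (hD : 2 < D) :
    linStabilizer (∑ i : Fin m, (X i : MvPolynomial (Fin m) k) ^ D) =
      Subgroup.closure
        ({γ : GL (Fin m) k | ∃ π : Equiv.Perm (Fin m), (γ : Matrix (Fin m) (Fin m) k) = π.permMatrix k} ∪
         {γ : GL (Fin m) k | ∃ t : Fin m → k, (γ : Matrix (Fin m) (Fin m) k) = Matrix.diagonal t ∧
            ∀ i, t i ^ D = 1}) := by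
  apply le_antisymm
  · intro γ hγ
    obtain ⟨π, t, ht, hmat⟩ := exists_perm_diagonal_of_mem_linStabilizer_psum hD γ hγ
    obtain ⟨P, hP⟩ := exists_gl_eq_permMatrix (k := k) π
    obtain ⟨T, hT⟩ := exists_gl_eq_diagonal_of_pow_eq_one (show D ≠ 0 by omega) t ht
    have hγPT : γ = P * T := by
      apply Matrix.GeneralLinearGroup.ext
      intro a b
      rw [hmat, Units.val_mul, hP, hT]
    rw [hγPT]
    exact Subgroup.mul_mem _ (Subgroup.subset_closure (Or.inl ⟨π, hP⟩))
      (Subgroup.subset_closure (Or.inr ⟨t, hT, ht⟩))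
  · rw [Subgroup.closure_le]
    rintro γ (⟨π, hπ⟩ | ⟨t, ht, ht1⟩)
    · exact mem_linStabilizer_psum_of_coe_eq γ π (fun _ => 1) (fun _ => one_pow _)
        (by rw [hπ, diagonal_one, mul_one])
    · exact mem_linStabilizer_psum_of_coe_eq γ 1 t ht1 (by rw [ht, Matrix.permMatrix_one, one_mul])

/-- The exponent `N(D) = D` (`D` even) resp. `2D` (`D` odd) of Prop. 2.4(2) is even and a multiple
of `D` (private arithmetic helper). [folklore] -/
private theorem even_periodExp (D : ℕ) : Even (if Even D then D else 2 * D) := by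
  split_ifs with h
  · exact h
  · exact even_two_mul D

/-- **The determinants of the stabilizer of `X_1^D + ⋯ + X_m^D`** (`D ≥ 3`, `m ≥ 2`, over `ℂ`) are
exactly the `N`-th roots of unity, `N = D` for `D` even and `N = 2D` for `D` odd: they are the
`sign(π) ∏ t_j` with `t_j^D = 1`; `ζ ∈ μ_D` comes from `diag(ζ,1,…,1)`, `-1` from a transposition, and
for odd `D` a root `u` with `u^D = -1` from `transposition · diag(-u,1,…,1)`.
[cite: BurgisserIkenmeyer2017, Prop. 2.4(2)] -/
theorem mem_stabilizerDetImage_psum_iff {D : ℕ} (hD : 2 < D) (hm : 1 < m) (u : ℂˣ) :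
    u ∈ stabilizerDetImage (∑ i : Fin m, (X i : MvPolynomial (Fin m) ℂ) ^ D) ↔
      u ^ (if Even D then D else 2 * D) = 1 := by
  classical
  have hD0 : D ≠ 0 := by omega
  set N := (if Even D then D else 2 * D) with hN
  have hNdvd : D ∣ N := by rw [hN]; split_ifs <;> simp
  rw [mem_stabilizerDetImage_iff]
  constructor
  · rintro ⟨γ, hγ, rfl⟩
    obtain ⟨π, t, ht, hmat⟩ := exists_perm_diagonal_of_mem_linStabilizer_psum hD γ hγ
    obtain ⟨e, he⟩ := hNdvd
    have h1 : (∏ i, t i) ^ N = 1 := by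
      rw [← Finset.prod_pow]
      exact Finset.prod_eq_one fun i _ => by rw [he, pow_mul, ht i, one_pow]
    apply Units.ext
    rw [Units.val_pow_eq_pow_val, Matrix.GeneralLinearGroup.val_det_apply, hmat, det_mul,
      det_permutation, det_diagonal, Units.val_one, mul_pow, h1, mul_one]
    rcases Int.units_eq_one_or (Equiv.Perm.sign π) with hs | hs
    · simp [hs]
    · have hNeven : Even N := hN ▸ even_periodExp D
      simp only [hs, Units.val_neg, Units.val_one, Int.cast_neg, Int.cast_one, hNeven.neg_one_pow]
  · intro hu
    have hu' : (u : ℂ) ^ N = 1 := by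
      rw [← Units.val_pow_eq_pow_val, hu, Units.val_one]
    -- the diagonal matrix `diag(w, 1, …, 1)` for a `D`-th root of unity `w`
    have hdiag : ∀ w : ℂ, w ^ D = 1 → ∃ T : GL (Fin m) ℂ,
        (T : Matrix (Fin m) (Fin m) ℂ) = diagonal (Function.update (fun _ => (1 : ℂ)) ⟨0, by omega⟩ w) ∧
        (∀ j, Function.update (fun _ => (1 : ℂ)) (⟨0, by omega⟩ : Fin m) w j ^ D = 1) ∧
        (T : Matrix (Fin m) (Fin m) ℂ).det = w := by
      intro w hw
      have ht : ∀ j, Function.update (fun _ => (1 : ℂ)) (⟨0, by omega⟩ : Fin m) w j ^ D = 1 := by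
        intro j
        rcases eq_or_ne j ⟨0, by omega⟩ with rfl | hj
        · rw [Function.update_self, hw]
        · rw [Function.update_of_ne hj, one_pow]
      obtain ⟨T, hT⟩ := exists_gl_eq_diagonal_of_pow_eq_one hD0 _ ht
      refine ⟨T, hT, ht, ?_⟩
      rw [hT, det_diagonal, Finset.prod_update_of_mem (Finset.mem_univ _), Finset.prod_const_one,
        mul_one]
    by_cases hcase : (u : ℂ) ^ D = 1
    · obtain ⟨T, hT, ht, hdet⟩ := hdiag (u : ℂ) hcase
      refine ⟨T, mem_linStabilizer_psum_of_coe_eq T 1 _ ht (by rw [hT, Matrix.permMatrix_one, one_mul]), ?_⟩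
      exact Units.ext (by rw [Matrix.GeneralLinearGroup.val_det_apply, hdet])
    · -- `D` odd and `u^D = -1`: use a transposition and `diag(-u, 1, …, 1)`
      have hodd : ¬ Even D := by
        intro heven
        rw [hN, if_pos heven] at hu'
        exact hcase hu'
      have hDodd : Odd D := Nat.not_even_iff_odd.mp hodd
      rw [hN, if_neg hodd, pow_mul', sq, mul_self_eq_one_iff] at hu'
      have huD : (u : ℂ) ^ D = -1 := hu'.resolve_left hcase
      have hv : (-(u : ℂ)) ^ D = 1 := by rw [hDodd.neg_pow, huD, neg_neg]
      obtain ⟨T, hT, ht, hdet⟩ := hdiag (-(u : ℂ)) hv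
      have h01 : (⟨0, by omega⟩ : Fin m) ≠ ⟨1, by omega⟩ := by simp [Fin.ext_iff]
      obtain ⟨P, hP⟩ := exists_gl_eq_permMatrix (k := ℂ) (Equiv.swap (⟨0, by omega⟩ : Fin m) ⟨1, by omega⟩)
      refine ⟨P * T, mem_linStabilizer_psum_of_coe_eq (P * T) _ _ ht (by rw [Units.val_mul, hP, hT]), ?_⟩
      apply Units.ext
      rw [Matrix.GeneralLinearGroup.val_det_apply, Units.val_mul, det_mul, hP, det_permutation,
        Equiv.Perm.sign_swap h01, hdet]
      simp

/-- **BI 2017, Prop. 2.4(2), second sentence**: the stabilizer period of `X_1^D + ⋯ + X_m^D`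
(`D ≥ 3`, `m ≥ 2`, over `ℂ`) is `D` for `D` even and `2D` for `D` odd — the image of `det` on the
stabilizer is the group of `N`-th roots of unity (`mem_stabilizerDetImage_psum_iff`), of order `N`
(`Complex.card_rootsOfUnity`). [cite: BurgisserIkenmeyer2017, Prop. 2.4(2)] -/
theorem stabilizerPeriod_psum {D : ℕ} (hD : 2 < D) (hm : 1 < m) :
    stabilizerPeriod (∑ i : Fin m, (X i : MvPolynomial (Fin m) ℂ) ^ D) =
      if Even D then D else 2 * D := by
  have hN0 : NeZero (if Even D then D else 2 * D) := ⟨by split_ifs <;> omega⟩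
  have heq : stabilizerDetImage (∑ i : Fin m, (X i : MvPolynomial (Fin m) ℂ) ^ D) =
      rootsOfUnity (if Even D then D else 2 * D) ℂ := by
    ext u
    rw [mem_stabilizerDetImage_psum_iff hD hm, mem_rootsOfUnity]
  rw [stabilizerPeriod_def, heq]
  exact Complex.card_rootsOfUnity _

/-- **BI 2017, Prop. 2.4(2) — the named fact `BI2017_prop_2_4_2` holds** ("Suppose `D > 2` and
`m > 1`. The stabilizer of the power sum `X_1^D + ⋯ + X_m^D` is the subgroup generated by the
permutation matrices and the diagonal matrices `diag(t_1,…,t_m)`, where `t_1^D = ⋯ = t_m^D = 1`. The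
stabilizer period of `X_1^D + ⋯ + X_m^D` equals `D` if `D` is even and `2D` if `D` is odd").
[cite: BurgisserIkenmeyer2017, Prop. 2.4(2)] -/
theorem BI2017_prop_2_4_2_holds : BI2017_prop_2_4_2 :=
  fun _ _ hD hm => ⟨linStabilizer_psum_eq_closure hD, stabilizerPeriod_psum hD hm⟩

end PowerSumStabilizer

end Literature.Computability.AlgebraicComplexity
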